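import Summits.Parity.GeneralizedHardyLittlewood.Theorems.LeeYangFibresCellParityLawSieveDefs
import Summits.Parity.GeneralizedHardyLittlewood.Theorems.LeeYangFibresCellParityLawSingularRatio
import Summits.Parity.GeneralizedHardyLittlewood.Theorems.LeeYangFibresCellParityLawModelDensityBounds
import Summits.Parity.GeneralizedHardyLittlewood.Theorems.LeeYangFibresCellParityLawEulerRatio
import Literature.NumberTheory.Sieve.LinearEquationsInPrimesLocalObstruction
import Literature.NumberTheory.Sieve.SieveFunctions
import Literature.NumberTheory.Sieve.SieveFramework
import Literature.NumberTheory.Sieve.RosserSieveTheoremOneHalfLt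
import Literature.NumberTheory.Sieve.LinearSieveConstant
import Literature.NumberTheory.Sieve.LinearFormsRoughTupleBound
import Literature.NumberTheory.Sieve.RoughOmegaCellsAsymptoticDensity
import Literature.NumberTheory.LFunctions.MertensFormula
import HarnessLib

/-!
# Route `LeeYangFibres`, crux `CellParityLaw` (stmt-Parity-14109), line `section-annihilator`:
# the registered stub `stub_prLawTwoPrep` — elementary preparations for the `u = 2` rung

(work file of the lead `prover-line-stmt-Parity-14109-c1-0`; module docstring to be completed at landing)
-/

noncomputable section

open scoped BigOperators Classical
open scoped Topology
open Finset Filter Literature.NumberTheory.Sieve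

namespace Summit.Parity.GeneralizedHardyLittlewood.Cruxes.CellParityLaw.SectionAnnihilator


namespace PrLawTwoAux

variable {t : ℕ}

/-! ## Elementary facts about the section data -/

/-- The values of a form of a system of size `‖Ψ‖_N ≤ L` on the box `[-N, N]` are at most `2 L N`
(`|a_i| ≤ L`, `|b_i| ≤ L N`). -/
theorem eval_le_two_mul {s : ℕ} {Ψ : Fin s → AffLinForm 1} {N L : ℕ} (hN : 0 < N)
    (hL : affLinSize Ψ N ≤ L) (k : Fin s) {n : Fin 1 → ℤ} (hn : n ∈ latticeBox 1 N) :
    (((Ψ k).eval n : ℤ) : ℝ) ≤ 2 * L * N := by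
  have ha : ((Ψ k).coeff 0).natAbs ≤ L := natAbs_coeff_le_of_affLinSize_le hL k 0
  have hb : ((Ψ k).const).natAbs ≤ L * N := SingularRatio.natAbs_const_le_of_affLinSize_le hN hL k
  have hn0 : n 0 ∈ Finset.Icc (-(N : ℤ)) N := by
    rw [latticeBox, Fintype.mem_piFinset] at hn
    exact hn 0
  rw [Finset.mem_Icc] at hn0
  have habs : |(Ψ k).eval n| ≤ 2 * L * N := by
    rw [AffLinForm.eval, Fin.sum_univ_one]
    have h1 : |(Ψ k).coeff 0 * n 0| ≤ L * N := by
      rw [abs_mul]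
      have hc : |(Ψ k).coeff 0| ≤ L := by
        rw [← Int.natCast_natAbs]; exact_mod_cast ha
      have hnn : |n 0| ≤ N := abs_le.mpr ⟨hn0.1, hn0.2⟩
      exact mul_le_mul hc hnn (abs_nonneg _) (by positivity)
    have h2 : |(Ψ k).const| ≤ L * N := by
      rw [← Int.natCast_natAbs]; exact_mod_cast hb
    calc |(Ψ k).coeff 0 * n 0 + (Ψ k).const| ≤ |(Ψ k).coeff 0 * n 0| + |(Ψ k).const| := abs_add_le _ _
      _ ≤ L * N + L * N := add_le_add h1 h2
      _ = 2 * L * N := by ring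
  have h := (le_abs_self _).trans habs
  exact_mod_cast h

/-- Under `2 ≤ N^{1/u}`, a lattice point in a joint cell of the full system has `ψ_i(n) ≥ 2`:
the roughness clause `N^{1/u} < P⁻(ψ_i(n).toNat)` excludes `ψ_i(n) ≤ 1` (`P⁻(0) = 2`, `P⁻(1) = 1`). -/
theorem two_le_eval_of_rough {N u : ℕ} (h2 : (2 : ℝ) ≤ (N : ℝ) ^ ((1 : ℝ) / u)) {v : ℤ}
    (hv : (N : ℝ) ^ ((1 : ℝ) / u) < (Nat.minFac v.toNat : ℝ)) : 2 ≤ v := by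
  by_contra hlt
  push Not at hlt
  have hle : v.toNat ≤ 1 := by omega
  have hmin : (Nat.minFac v.toNat : ℝ) ≤ 2 := by
    rcases Nat.le_one_iff_eq_zero_or_eq_one.mp hle with h0 | h1
    · rw [h0, Nat.minFac_zero]; norm_num
    · rw [h1, Nat.minFac_one]; norm_num
  linarith

/-- A joint cell of the full system (cell index `m` at the coordinate `i`, the frozen cells `j'`
elsewhere) lies in the support of the `i`-th section: `C_{(m,j')} ≤ F⁽ⁱ⁾_{j'}` (forget the conditions
on `ψ_i` except positivity, which roughness gives once `N^{1/u} ≥ 2`). -/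
theorem cell_le_sectionMass (Ψ : Fin (t + 1) → AffLinForm 1) (K : Set (Fin 1 → ℝ)) {N u : ℕ}
    (h2 : (2 : ℝ) ≤ (N : ℝ) ^ ((1 : ℝ) / u)) (i : Fin (t + 1)) (j' : Fin t → ℕ) (m : ℕ) :
    cell Ψ K N u (i.insertNth m j') ≤ sectionMass Ψ K N u i j' 1 := by
  unfold cell sectionMass
  refine Finset.card_le_card fun n hn => ?_
  simp only [Finset.mem_filter] at hn ⊢
  obtain ⟨hbox, hK, hall⟩ := hn
  refine ⟨hbox, hK, ?_, ⟨(Ψ i).eval n, by ring⟩, fun k => ?_⟩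
  · have h := (hall i).1
    have := two_le_eval_of_rough h2 h
    omega
  · have h := hall (i.succAbove k)
    rw [Fin.insertNth_apply_succAbove] at h
    exact h

/-- The support of a section lies in the rough tuples of the frozen sub-system `Ψ₋ᵢ`:
`F⁽ⁱ⁾_{j'} ≤ #{n ∈ [-N,N] : P⁻(ψ_{i.succAbove k}(n)) > N^{1/u} ∀ k}`. -/
theorem sectionMass_le_card_rough (Ψ : Fin (t + 1) → AffLinForm 1) (K : Set (Fin 1 → ℝ)) (N u : ℕ)
    (i : Fin (t + 1)) (j' : Fin t → ℕ) :
    sectionMass Ψ K N u i j' 1 ≤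
      ((latticeBox 1 N).filter fun n =>
        ∀ k : Fin t, (N : ℝ) ^ ((1 : ℝ) / u) <
          (Nat.minFac ((Fin.removeNth i Ψ k).eval n).toNat : ℝ)).card := by
  unfold sectionMass
  refine Finset.card_le_card fun n hn => ?_
  simp only [Finset.mem_filter] at hn ⊢
  exact ⟨hn.1, fun k => by rw [Fin.removeNth_apply]; exact (hn.2.2.2.2 k).1⟩

/-! ## The prime-cell model density `a_1 = (π(N) − π(N^{1/2}))/N` from below, with a rate -/

/-- **`a_1 ≥ 1/log N − C/log² N` at `u = 2`**: the tree's effective rough-prime-cell bound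
`le_card_roughIcc_sqrt_cardFactors_one` (Alladi's asymptotic with rate), divided by `N`. [cite: Alladi1982, Theorem 1] -/
theorem modelDensity_two_one_lower :
    ∃ C : ℝ, 0 ≤ C ∧ ∀ N : ℕ, 3 ≤ N → 1 / Real.log N - C / Real.log N ^ 2 ≤ modelDensity N 2 1 := by
  obtain ⟨C, hC0, hC⟩ := le_card_roughIcc_sqrt_cardFactors_one
  refine ⟨C, hC0, fun N hN => ?_⟩
  have hN0 : (0 : ℝ) < N := by exact_mod_cast (by omega : 0 < N)
  have h := hC N hN
  rw [modelDensity_eq_card_div le_rfl, le_div_iff₀ hN0]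
  simp only [Nat.cast_ofNat]
  have e : (1 / Real.log N - C / Real.log N ^ 2) * N = (N : ℝ) / Real.log N - C * N / Real.log N ^ 2 := by
    ring
  rw [e]
  exact h

/-! ## Degenerate primes of the section density: `g(p) = 1` -/

/-- If `g_{Ψ,i}(p) = 1` at a prime `p`, Bombieri's constant vanishes: the Euler partial products carry the
factor `(1 - 1)(1 - 1/p)⁻¹ = 0` from `p` on, so their ordered limit is `0`. -/
theorem sectionH_eq_zero_of_density_one (Ψ : Fin (t + 1) → AffLinForm 1) (i : Fin (t + 1)) {p : ℕ}
    (hp : p.Prime) (h1 : sectionDensity Ψ i p = 1) : sectionH Ψ i = 0 := by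
  have hev : ∀ x : ℕ, p ≤ x →
      ∏ q ∈ Nat.primesLE x, (1 - sectionDensity Ψ i q) / (1 - (q : ℝ)⁻¹) = 0 := fun x hx =>
    Finset.prod_eq_zero (Nat.mem_primesLE.mpr ⟨hx, hp⟩) (by rw [h1, sub_self, zero_div])
  have hlim : Tendsto (fun x : ℕ => ∏ q ∈ Nat.primesLE x, (1 - sectionDensity Ψ i q) / (1 - (q : ℝ)⁻¹))
      atTop (𝓝 0) :=
    tendsto_const_nhds.congr' (by
      filter_upwards [eventually_ge_atTop p] with x hx
      exact (hev x hx).symm)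
  unfold sectionH
  exact hlim.limUnder_eq

/-- If `g_{Ψ,i}(p) = 1` at a prime `p`, then `goodCount Ψ p = 0`: every residue mod `p` is a zero of some
form of the FULL system (`g(p) = (g'_p - g_p)/g'_p = 1` forces `g'_p ≠ 0` and `g_p = 0`). -/
theorem goodCount_eq_zero_of_density_one (Ψ : Fin (t + 1) → AffLinForm 1) (i : Fin (t + 1)) {p : ℕ}
    [hp : Fact p.Prime] (h1 : sectionDensity Ψ i p = 1) : goodCount Ψ p = 0 := by
  rw [EulerRatioAux.sectionDensity_prime Ψ i] at h1
  set G' : ℝ := (goodCount (Fin.removeNth i Ψ) p : ℝ) with hG'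
  set G : ℝ := (goodCount Ψ p : ℝ) with hG
  by_cases h0 : G' = 0
  · rw [h0, div_zero] at h1; exact absurd h1 zero_ne_one
  · rw [div_eq_one_iff_eq h0] at h1
    have hG0 : (goodCount Ψ p : ℝ) = 0 := by rw [← hG]; linarith
    exact_mod_cast hG0

/-- A degenerate prime is small: if `goodCount Ψ p = 0` for a non-degenerate system of size `≤ L`, then
`p ≤ max(t + 1, L)` (for `p > L` all leading coefficients are units mod `p`, and `t + 1` such forms kill
at most `t + 1` residues, `le_goodCount_add`), and every lattice point has a form divisible by `p`. -/
theorem small_and_dvd_of_goodCount_eq_zero (Ψ : Fin (t + 1) → AffLinForm 1) (hΨ : IsNondegenerateSystem Ψ)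
    {L N : ℕ} (hL : affLinSize Ψ N ≤ L) {p : ℕ} [hp : Fact p.Prime] (hG : goodCount Ψ p = 0) :
    p ≤ max (t + 1) L ∧ ∀ n : Fin 1 → ℤ, ∃ k : Fin (t + 1), (p : ℤ) ∣ (Ψ k).eval n := by
  refine ⟨?_, fun n => ?_⟩
  · by_contra hlt
    push Not at hlt
    have hLp : L < p := lt_of_le_of_lt (le_max_right (t + 1) L) hlt
    have h := le_goodCount_add Ψ p (coeff_ne_zero_mod_of_affLinSize_le hΨ hL hLp)
    omega
  · have hv : ¬ ∀ k, ¬ (Ψ k).modEval p (fun j => ((n j : ℤ) : ZMod p)) = 0 := by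
      intro hall
      have hpos : 0 < goodCount Ψ p :=
        Finset.card_pos.mpr ⟨_, Finset.mem_filter.mpr ⟨Finset.mem_univ _, hall⟩⟩
      omega
    push Not at hv
    obtain ⟨k, hk⟩ := hv
    refine ⟨k, ?_⟩
    rw [← ZMod.intCast_zmod_eq_zero_iff_dvd, AffLinForm.intCast_eval]
    exact hk

/-- **Empty cells at a degenerate prime**: if every lattice point has a form of the full system divisible by
a prime `p < N^{1/u}` and `2 ≤ N^{1/u}`, every joint cell is empty. -/
theorem cell_eq_zero_of_forall_dvd (Ψ : Fin (t + 1) → AffLinForm 1) {N u p : ℕ} (hp : p.Prime)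
    (hpN : (p : ℝ) < (N : ℝ) ^ ((1 : ℝ) / u)) (h2N : (2 : ℝ) ≤ (N : ℝ) ^ ((1 : ℝ) / u))
    (hdiv : ∀ n : Fin 1 → ℤ, ∃ k : Fin (t + 1), (p : ℤ) ∣ (Ψ k).eval n)
    (K : Set (Fin 1 → ℝ)) (j : Fin (t + 1) → ℕ) : cell Ψ K N u j = 0 := by
  unfold cell
  rw [Finset.card_eq_zero, Finset.filter_eq_empty_iff]
  rintro n - ⟨-, hall⟩
  obtain ⟨k, hk⟩ := hdiv n
  obtain ⟨hlt, -⟩ := hall k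
  rcases le_or_gt ((Ψ k).eval n) 0 with hm | hm
  · rw [Int.toNat_of_nonpos hm, Nat.minFac_zero, Nat.cast_ofNat] at hlt
    linarith
  · have hpd : p ∣ ((Ψ k).eval n).toNat := by
      rw [← Int.natCast_dvd_natCast, Int.toNat_of_nonneg hm.le]
      exact hk
    have h1 : (Nat.minFac ((Ψ k).eval n).toNat : ℝ) ≤ p := by
      exact_mod_cast Nat.minFac_le_of_dvd hp.two_le hpd
    linarith

/-! ## Re-indexing the divisor-sequence remainders into the atom's moduli -/

/-- **Injective re-indexing `(p, d) ↦ pd`**: for non-negative `F`, a finset `P` of primes `p ≥ z` and the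
divisors `d < Y` of `P(z)` (squarefree, all prime factors `< z`), with `pd ≤ M` throughout,
`∑_{p ∈ P} ∑_{d} F(pd) ≤ ∑_{1 ≤ m ≤ M, m squarefree} F(m)` (`pd = p'd'` forces `p = p'`, since `p ∤ d'`). -/
theorem sum_sum_mul_le_sum_squarefree (F : ℕ → ℝ) (P : Finset ℕ) (z : ℝ) (Y M : ℕ)
    (hF : ∀ m, 0 ≤ F m) (hP : ∀ p ∈ P, p.Prime ∧ z ≤ (p : ℝ))
    (hM : ∀ p ∈ P, ∀ d ∈ (Finset.range Y).filter (· ∣ primesProdBelow z), p * d ≤ M) :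
    ∑ p ∈ P, ∑ d ∈ (Finset.range Y).filter (· ∣ primesProdBelow z), F (p * d) ≤
      ∑ m ∈ (Finset.Icc 1 M).filter Squarefree, F m := by
  set D := (Finset.range Y).filter (· ∣ primesProdBelow z) with hD
  have hDprop : ∀ d ∈ D, d ∣ primesProdBelow z := fun d hd => (Finset.mem_filter.mp hd).2
  -- no prime of `P` divides a member of `D`
  have hnd : ∀ p ∈ P, ∀ d ∈ D, ¬ p ∣ d := by
    intro p hp d hd hpd
    obtain ⟨hpp, hpz⟩ := hP p hp
    have hlt : (p : ℝ) < z := (dvd_primesProdBelow_iff hpp z).mp (hpd.trans (hDprop d hd))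
    linarith
  rw [← Finset.sum_product (s := P) (t := D) (f := fun x : ℕ × ℕ => F (x.1 * x.2))]
  -- injectivity of `(p, d) ↦ p d` on `P × D`
  have hinj : Set.InjOn (fun x : ℕ × ℕ => x.1 * x.2) ((P ×ˢ D : Finset (ℕ × ℕ)) : Set (ℕ × ℕ)) := by
    rintro ⟨p, d⟩ hx ⟨p', d'⟩ hx' heq
    simp only [Finset.coe_product, Set.mem_prod, Finset.mem_coe] at hx hx'
    change p * d = p' * d' at heq
    have hpp := (hP p hx.1).1
    have hpp' := (hP p' hx'.1).1
    have hpd : p ∣ p' * d' := ⟨d, heq.symm⟩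
    have hp_eq : p = p' := by
      rcases (Nat.Prime.dvd_mul hpp).mp hpd with h | h
      · exact (Nat.prime_dvd_prime_iff_eq hpp hpp').mp h
      · exact absurd h (hnd p hx.1 d' hx'.2)
    subst hp_eq
    have hd_eq : d = d' := Nat.eq_of_mul_eq_mul_left hpp.pos heq
    subst hd_eq
    rfl
  rw [← Finset.sum_image (f := F) hinj]
  refine Finset.sum_le_sum_of_subset_of_nonneg (fun m hm => ?_) fun m _ _ => hF m
  rw [Finset.mem_image] at hm
  obtain ⟨⟨p, d⟩, hx, rfl⟩ := hm
  rw [Finset.mem_product] at hx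
  obtain ⟨hp, hd⟩ := hx
  obtain ⟨hpp, -⟩ := hP p hp
  have hd0 : d ≠ 0 := fun h => by
    have := hDprop d hd; rw [h, zero_dvd_iff] at this; exact primesProdBelow_ne_zero z this
  refine Finset.mem_filter.mpr ⟨Finset.mem_Icc.mpr ⟨?_, hM p hp d hd⟩, ?_⟩
  · exact Nat.one_le_iff_ne_zero.mpr (Nat.mul_ne_zero hpp.ne_zero hd0)
  · change Squarefree (p * d)
    have hcop : Nat.Coprime p d := (Nat.Prime.coprime_iff_not_dvd hpp).mpr (hnd p hp d hd)
    exact (Nat.squarefree_mul hcop).mpr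
      ⟨hpp.squarefree, (squarefree_primesProdBelow z).squarefree_of_dvd (hDprop d hd)⟩

end PrLawTwoAux

open PrLawTwoAux in
/-- **`stub_prLawTwoPrep`** (registered stub of the line `section-annihilator`, skeleton v9): the elementary
preparations `PrLawTwoPrep` for the `u = 2` rung — degenerate primes and local obstructions (empty cells,
vanishing model factor, for `N ≥ (max(t+1, L) + 2)^u`), the prime-cell density `a_1` from below with a rate
(Alladi), the inclusions cell ⊆ section support ⊆ rough tuples of `Ψ₋ᵢ`, the value bound `2LN`, and the
injective re-indexing of the divisor-sequence remainders. -/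
theorem stub_prLawTwoPrep : PrLawTwoPrep := by
  refine ⟨?_, modelDensity_two_one_lower, ?_, ?_, ?_⟩
  · -- (a) degenerate cases
    intro t L u hu
    refine ⟨(max (t + 1) L + 2) ^ u, fun N hN Ψ hΨ hL K i j' hdeg => ?_⟩
    have hu0 : u ≠ 0 := by omega
    have hNpos : 0 < N := lt_of_lt_of_le (pow_pos (by positivity) u) hN
    -- `N^{1/u} ≥ max(t+1, L) + 2`
    have hroot : ((max (t + 1) L + 2 : ℕ) : ℝ) ≤ (N : ℝ) ^ ((1 : ℝ) / u) := by
      have h1 : (((max (t + 1) L + 2) ^ u : ℕ) : ℝ) ≤ N := by exact_mod_cast hN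
      have h2 : (((max (t + 1) L + 2 : ℕ) : ℝ) ^ (u : ℕ)) ^ ((1 : ℝ) / u) ≤ (N : ℝ) ^ ((1 : ℝ) / u) :=
        Real.rpow_le_rpow (by positivity) (by exact_mod_cast h1) (by positivity)
      rwa [← Real.rpow_natCast, ← Real.rpow_mul (by positivity), mul_one_div_cancel
        (by exact_mod_cast hu0 : (u : ℝ) ≠ 0), Real.rpow_one] at h2
    have h2N : (2 : ℝ) ≤ (N : ℝ) ^ ((1 : ℝ) / u) :=
      le_trans (by exact_mod_cast (by omega : 2 ≤ max (t + 1) L + 2)) hroot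
    rcases hdeg with ⟨p, hp, h1⟩ | h0
    · -- a degenerate prime of the density
      haveI := Fact.mk hp
      have hG := goodCount_eq_zero_of_density_one Ψ i h1
      obtain ⟨hpsmall, hdiv⟩ := small_and_dvd_of_goodCount_eq_zero Ψ hΨ hL hG
      have hpN : (p : ℝ) < (N : ℝ) ^ ((1 : ℝ) / u) := by
        have : (p : ℝ) < ((max (t + 1) L + 2 : ℕ) : ℝ) := by exact_mod_cast (by omega)
        exact this.trans_le hroot
      exact ⟨fun m => cell_eq_zero_of_forall_dvd Ψ hp hpN h2N hdiv K _,
        by rw [sectionH_eq_zero_of_density_one Ψ i hp h1, zero_mul]⟩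
    · -- a local obstruction of the frozen sub-system
      obtain ⟨p, hp, hpsmall, hdiv⟩ := EulerRatioAux.exists_small_prime_dvd Ψ hΨ hL i h0
      have hpN : (p : ℝ) < (N : ℝ) ^ ((1 : ℝ) / u) := by
        have : (p : ℝ) < ((max (t + 1) L + 2 : ℕ) : ℝ) := by
          have : p ≤ max (t + 1) L := hpsmall.trans (max_le_max (Nat.le_succ t) le_rfl)
          exact_mod_cast (by omega)
        exact this.trans_le hroot
      have hB := EulerRatioAux.sectionMass_eq_zero Ψ i hp hpN h2N hdiv K j'
      refine ⟨fun m => ?_, by rw [hB, Nat.cast_zero, mul_zero]⟩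
      have := cell_le_sectionMass Ψ K h2N i j' m
      omega
  · -- (c) inclusions
    intro t Ψ K N u i j' h2
    exact ⟨fun m => cell_le_sectionMass Ψ K h2 i j' m, sectionMass_le_card_rough Ψ K N u i j'⟩
  · -- (d) values
    intro s Ψ N L hN hL k n hn
    exact eval_le_two_mul hN hL k hn
  · -- (e) re-indexing
    intro F P z Y M hF hP hM
    exact sum_sum_mul_le_sum_squarefree F P z Y M hF hP hM

end Summit.Parity.GeneralizedHardyLittlewood.Cruxes.CellParityLaw.SectionAnnihilator

end
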